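import Summits.QuantumFields.YangMills.Theorems.BalabanUVNodesN07ChartHInvTwistedLetter
import HarnessLib

/-!
# BalabanUVNodes ∕ N07 — THE TWISTED (46) LETTERS OF THE ROUTE's CORRECTED RIGHT INVERSE WITH THE BLOCK SLACK AT THE TERRITORY LEVEL ONLY (the form multiscale-distance
# twists satisfy) — part 1′: the three `hE`-dependent Construction-section lemmas of `…N07ChartHInvTwistedLetter` re-run

Cell `pub-ymgap`, width seat `pub-ymgap-dag-n07-w2` generation 4 (D-0149; N07 = [15]; S2 «Prop. 3 at objects», (73) with decay).  `--kind proof --supports … --as helper`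
(K1 face; count-neutral).  WHY.  In `…N07ChartHInvTwistedLetter` the block slack (s3) was displayed as «`dE(b) ≤ dE(b′) + r₂` whenever `b′₋` lies in the `j`-block of an
end-point `x` of `b` for SOME `j ≤ k`»; the proofs use it ONLY at `j = j(x)`, the TERRITORY level of `x` (the pin of the tent of `x`).  For the physical one-level distance
`distBI` the strong form holds (`…N07ChartDDecayRefBond`), but for [3]'s MULTISCALE distance `d` (the port's `dBI = d_T + 3`, in which (162)'s row sum is stated and in
which the `θ₀` column letter of `𝔇ᵀ` must be summed) a fine bond deep inside a coarse block can be far from `x` — the strong (s3) fails, the territory-level (s3′) holds.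
This file re-runs the three `hE`-dependent lemmas with (s3′): `iterBlockOf (levOf x) b′₋ = iterBlockOf (levOf x) x → dE(b) ≤ dE(b′) + r₂`; everything else is consumed BY NAME
from part 1 (`norm_Xf∕kappa∕Xt_le_twisted`, `letter_Y_twisted`) and the route's `ChartHInv`.

WHAT IS PROVED (sorry-free; no definition; axioms standard): `norm_Lam_pin_le_twisted_terr` (at a site index pinning `x`, the pin level IS `levOf x` —
`FlatCubeLevels.levOf_inOm_unique`), `norm_dphi_le_twisted_terr`, ★★ `letter_twisted_terr` (`e^{δdE(b)}w₁(b)‖HX(b)‖ ≤ C_KB₃(1+2Ce^{δr₁})(1+2C(1+L)e^{δr₂})·t` under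
(s1), (s2), (s3′)).  Part 2′ (`…N07ChartHInvTwistedTerr`) packages `∃ H` and the end-to-end (73) with (s3′).

HONEST FRAMING: count-neutral helper; proofs = part 1's with one hypothesis read at the territory level; nothing of [15] Sects. D–F asserted; stub 1 ∕ K0⁷ ∕ K1⁸ NOT closed;
N07 NOT discharged; counts unmoved; one finite T⁴ programme at fixed ε — NOT continuum ∕ ℝ⁴ ∕ OS ∕ mass gap ∕ Clay: the Yang–Mills mass gap is NOT proved by any of this; R4
closes the conditional rung `BalabanLadder.UV` only.  No `sorry`, no `def`, no `instance`, no `notation`.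

References: [15] T. Bałaban, CMP 102 (1985) 277–309 [Balaban1985Variational] ((45)–(46) p.285, (71) p.289, (161)–(162) p.303); [3] = [B6] CMP 96 (1984) 223–250
[Balaban1984PropagatorsII] ((2.1)–(2.4) p.224, Lemma 2.1 p.232, (2.46) p.231, Cor. 2.8 (2.150)–(2.151) p.249); [4] = [B7] CMP 98 (1985) 17–51 [Balaban1985Averaging] ((62) p.28).
-/

noncomputable section

open scoped BigOperators Matrix.Norms.L2Operator

namespace Summit.QuantumFields.YangMills.BalabanUVNodes.N07ChartHInvTwistedTerr

open Literature.MathematicalPhysics.QuantumFieldTheory.Balaban1983to89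
open T4Continuum BlockAveraging BlockAveragingEMLLinearised LatticeFieldCalculus
open B5Eq118OneStroke (iterBlockOf iterBlockOf_zero iterBlockOf_succ)
open B15DeterminingSets (embIter)
open B6SectADomainsV1 (Domains)
open B6SectAOperatorsV1 (BondIdx SiteIdx)
open B11Eq115Space (levOf)
open Summit.QuantumFields.YangMills.Theorems (FlatCubeLevels.levOf_inOm_unique FlatCubeLevels.lamSite_levOf_inOm FlatCubeLevels.levOf_inOm_le)
open Summit.QuantumFields.YangMills.Theorems.FlatCubeOpsText (Adm22)
open Summit.QuantumFields.YangMills.Theorems.Prop8Chart (collar_of_adm22)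
open Summit.QuantumFields.YangMills.Theorems.Prop7CombGauge (combMean_add)
open Summit.QuantumFields.YangMills.Theorems.ChartHInv
open Summit.QuantumFields.YangMills.BalabanUVNodes.N07ChartHInvTwisted (norm_Xf_le_twisted norm_kappa_le_twisted norm_Xt_le_twisted letter_Y_twisted)
open Literature.MathematicalPhysics.QuantumFieldTheory.BalabanImbrieJaffe1984to88.BIJ88RT51Background (iterBlockOf_embIter)

variable {P : Params} {n : Type*}

section Construction

variable (D : Domains P) (η : ℝ)
  (Λ : (i : ℕ) → (PBond P 0 → Matrix n n ℂ) → Site P i → Matrix n n ℂ)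
  (hΛ0 : ∀ Y y, Λ 0 Y y = 0)
  (hΛs : ∀ (i : ℕ) (Y : PBond P 0 → Matrix n n ℂ) (y : Site P (i + 1)), Λ (i + 1) Y y = (P.L ^ i : ℕ) • combMean (bondAvgIter i Y) y + Λ i Y (emb y))
  (Xf : (BondIdx D → Matrix n n ℂ) → (i : ℕ) → PBond P i → Matrix n n ℂ)
  (hXf : ∀ X i b, Xf X i b = if h : D.LamBond i b then X ⟨⟨⟨i, Nat.lt_succ_of_le (D.le_of_lamBond h)⟩, b⟩, h⟩ else 0)
  (κ : (BondIdx D → Matrix n n ℂ) → (j : ℕ) → Site P j → Matrix n n ℂ)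
  (hκ0 : ∀ X y, κ X 0 y = 0)
  (hκs : ∀ X (i : ℕ) (y : Site P (i + 1)), κ X (i + 1) y = if y ∈ D.Om (i + 1) then 0 else combMean (Xf X i) y)
  (Xt : (BondIdx D → Matrix n n ℂ) → BondIdx D → Matrix n n ℂ)
  (hXt : ∀ X idx, Xt X idx = (((P.L : ℝ) ^ (idx.1.1 : ℕ) * η)⁻¹) • (X idx + (κ X idx.1.1 idx.1.2.tgt - κ X idx.1.1 idx.1.2.src)))
  (H₀ : (BondIdx D → ℝ) →ₗ[ℝ] (PBond P 0 → ℝ))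
  (Y : (BondIdx D → Matrix n n ℂ) → PBond P 0 → Matrix n n ℂ)
  (hY : ∀ X b, Y X b = ∑ i : BondIdx D, H₀ (Pi.single i 1) b • Xt X i)
  (τ : SiteIdx D → Site P 0 → ℝ)
  (hτ0 : ∀ s x, iterBlockOf (s.1.1 : ℕ) x ≠ s.1.2 → τ s x = 0)
  (φ : (BondIdx D → Matrix n n ℂ) → Site P 0 → Matrix n n ℂ)
  (hφ : ∀ X x, φ X x = ∑ s : SiteIdx D, τ s x • Λ (s.1.1 : ℕ) (Y X) s.1.2)

section Letter

variable [Fintype n] [DecidableEq n]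
  (w₁ : PBond P 0 → ℝ) (hw₁ : ∀ b, w₁ b = (P.L : ℝ) ^ levOf (fun i => {z : Site P 0 | D.InOm i z}) D.k b.src * η)
  (hτlip : ∀ (s : SiteIdx D) (b : PBond P 0), |τ s b.tgt - τ s b.src| ≤ 2 / (P.L : ℝ) ^ (s.1.1 : ℕ))
  -- the kernel row of `H₀` over a bipartite distance and its row sum at the half rate
  (dBI : PBond P 0 → BondIdx D → ℝ) (hd0 : ∀ b c, 0 ≤ dBI b c) {CK δ₀ B₃ : ℝ} (hCK : 0 ≤ CK)
  (hker : ∀ (c : BondIdx D) (b : PBond P 0), |H₀ (Pi.single c 1) b| ≤ CK * Real.exp (-(δ₀ * dBI b c)))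
  (hrow : ∀ b, w₁ b * ∑ c : BondIdx D, Real.exp (-(δ₀ / 2 * dBI b c)) * ((P.L : ℝ) ^ (c.1.1 : ℕ) * η)⁻¹ ≤ B₃)
  -- the twists: «distances to a fixed block» on the fine bonds ∕ index bonds, with their slacks
  (dE : PBond P 0 → ℝ) (dF : BondIdx D → ℝ) {δ r₁ r₂ : ℝ} (hδ : 0 ≤ δ) (hδh : δ ≤ δ₀ / 2)
  (htri : ∀ b c, dE b ≤ dBI b c + dF c)
  (hF : ∀ (i c : BondIdx D) (x : Site P 0),
    (iterBlockOf (i.1.1 : ℕ) x = i.1.2.src ∨ iterBlockOf (i.1.1 : ℕ) x = i.1.2.tgt) →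
    (iterBlockOf (c.1.1 : ℕ) x = c.1.2.src ∨ iterBlockOf (c.1.1 : ℕ) x = c.1.2.tgt) → dF i ≤ dF c + r₁)

include hΛ0 hΛs hXf hκ0 hκs hXt hY hw₁ hd0 hCK hker hrow hδ hδh htri hF in
/-- **LOCAL SIZE OF THE PINNED VALUES, TWISTED (territory-level block slack as a premise)**: at the site index `s = (j, y)` pinning an end-point `x` of the fine bond `b` (`Bʲ(x) = y`),
`‖Λ_j(Y)(y)‖ ≤ (d+2)L·Lʲ·C_KB₃A·e^{δr₂}·t·e^{−δ·dE(b)}∕(Lʲη)` — inside `Bʲ(y)` every fine bond has territory `j` and lies within the slack `r₂` of `b`.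
[cite: Balaban1985Variational, (46) p.285; Balaban1985Averaging, (62) p.28] -/
theorem norm_Lam_pin_le_twisted_terr (hη : 0 < η) (hB₃ : 0 ≤ B₃) (X : BondIdx D → Matrix n n ℂ) {t : ℝ} (ht : 0 ≤ t)
    (hX : ∀ c, Real.exp (δ * dF c) * ‖X c‖ ≤ t) (b : PBond P 0) (x : Site P 0) (hx : x = b.src ∨ x = b.tgt)
    (s : SiteIdx D) (hs : iterBlockOf (s.1.1 : ℕ) x = s.1.2) :
    (∀ (b₁ b' : PBond P 0) (x : Site P 0), (x = b₁.src ∨ x = b₁.tgt) →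
      iterBlockOf (levOf (fun i => {z : Site P 0 | D.InOm i z}) D.k x) b'.src = iterBlockOf (levOf (fun i => {z : Site P 0 | D.InOm i z}) D.k x) x →
      dE b₁ ≤ dE b' + r₂) →
    ‖Λ (s.1.1 : ℕ) (Y X) s.1.2‖ ≤ ((P.d + 2) * P.L : ℕ) * (P.L : ℝ) ^ (s.1.1 : ℕ) *
      (CK * B₃ * (1 + 2 * ((P.d + 2) * P.L : ℕ) * Real.exp (δ * r₁)) * t * Real.exp (δ * r₂) * Real.exp (-(δ * dE b)) /
        ((P.L : ℝ) ^ (s.1.1 : ℕ) * η)) := by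
  intro hE
  have hj : (s.1.1 : ℕ) ≤ P.m + P.K := (D.le_of_lamSite s.2).trans D.hk
  have hwpos : 0 < (P.L : ℝ) ^ (s.1.1 : ℕ) * η := by have := P.L_pos; positivity
  refine norm_combFamily_le Λ hΛ0 hΛs hj (Y X) s.1.2 (by positivity) fun b' hbs _ => ?_
  have hlev : levOf (fun i => {z : Site P 0 | D.InOm i z}) D.k b'.src = (s.1.1 : ℕ) :=
    FlatCubeLevels.levOf_inOm_unique D (by rw [hbs]; exact s.2)
  have hl := letter_Y_twisted D η Xf hXf κ hκ0 hκs Xt hXt H₀ Y hY w₁ hw₁ dBI hd0 hCK hker hrow dE dF hδ hδh htri hF hη X ht hX b'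
  rw [hw₁, hlev] at hl
  -- the slack: `dE b ≤ dE b′ + r₂` (the pin level `s.1.1` IS the territory level of `x`)
  have hlevx : levOf (fun i => {z : Site P 0 | D.InOm i z}) D.k x = (s.1.1 : ℕ) := FlatCubeLevels.levOf_inOm_unique D (by rw [hs]; exact s.2)
  have hsl : dE b ≤ dE b' + r₂ := hE b b' x hx (by rw [hlevx, hbs, hs])
  have hexp : Real.exp (-(δ * dE b')) ≤ Real.exp (δ * r₂) * Real.exp (-(δ * dE b)) := by
    rw [← Real.exp_add]; exact Real.exp_le_exp.mpr (by nlinarith [mul_le_mul_of_nonneg_left hsl hδ])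
  rw [le_div_iff₀ hwpos]
  have hb'pos : 0 < Real.exp (δ * dE b') := Real.exp_pos _
  -- `‖Y X b′‖·(Lʲη) ≤ C_KB₃A·t·e^{−δdE(b′)} ≤ C_KB₃A·t·e^{δr₂}e^{−δdE(b)}`
  have h1 : ‖Y X b'‖ * ((P.L : ℝ) ^ (s.1.1 : ℕ) * η) ≤
      CK * B₃ * (1 + 2 * ((P.d + 2) * P.L : ℕ) * Real.exp (δ * r₁)) * t * Real.exp (-(δ * dE b')) := by
    rw [Real.exp_neg, ← div_eq_mul_inv, le_div_iff₀ hb'pos]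
    calc ‖Y X b'‖ * ((P.L : ℝ) ^ (s.1.1 : ℕ) * η) * Real.exp (δ * dE b') = Real.exp (δ * dE b') * ((P.L : ℝ) ^ (s.1.1 : ℕ) * η * ‖Y X b'‖) := by ring
      _ ≤ _ := hl
  refine h1.trans ?_
  have h0 : 0 ≤ CK * B₃ * (1 + 2 * ((P.d + 2) * P.L : ℕ) * Real.exp (δ * r₁)) * t := by positivity
  calc CK * B₃ * (1 + 2 * ((P.d + 2) * P.L : ℕ) * Real.exp (δ * r₁)) * t * Real.exp (-(δ * dE b'))
      ≤ CK * B₃ * (1 + 2 * ((P.d + 2) * P.L : ℕ) * Real.exp (δ * r₁)) * t * (Real.exp (δ * r₂) * Real.exp (-(δ * dE b))) :=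
        mul_le_mul_of_nonneg_left hexp h0
    _ = _ := by ring

include hΛ0 hΛs hXf hκ0 hκs hXt hY hτ0 hφ hw₁ hτlip hd0 hCK hker hrow hδ hδh htri hF in
/-- **THE GAUGE PART, TWISTED (territory-level block slack as a premise)**: `‖φ(b₊) − φ(b₋)‖ ≤ 2(d+2)L·C_KB₃A·e^{δr₂}·t·e^{−δ·dE(b)}·((L^{j₋}η)⁻¹ + (L^{j₊}η)⁻¹)` (only the two tents of the end-points'
territories move across `b`, slope `2∕Lʲ`). [cite: Balaban1985Variational, (46) p.285] -/
theorem norm_dphi_le_twisted_terr (hη : 0 < η) (hB₃ : 0 ≤ B₃) (X : BondIdx D → Matrix n n ℂ) {t : ℝ} (ht : 0 ≤ t)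
    (hX : ∀ c, Real.exp (δ * dF c) * ‖X c‖ ≤ t) (b : PBond P 0) :
    (∀ (b₁ b' : PBond P 0) (x : Site P 0), (x = b₁.src ∨ x = b₁.tgt) →
      iterBlockOf (levOf (fun i => {z : Site P 0 | D.InOm i z}) D.k x) b'.src = iterBlockOf (levOf (fun i => {z : Site P 0 | D.InOm i z}) D.k x) x →
      dE b₁ ≤ dE b' + r₂) →
    ‖φ X b.tgt - φ X b.src‖ ≤
      2 * ((P.d + 2) * P.L : ℕ) * (CK * B₃ * (1 + 2 * ((P.d + 2) * P.L : ℕ) * Real.exp (δ * r₁)) * t * Real.exp (δ * r₂) * Real.exp (-(δ * dE b))) *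
        ((((P.L : ℝ) ^ levOf (fun i => {z : Site P 0 | D.InOm i z}) D.k b.src * η)⁻¹) +
          (((P.L : ℝ) ^ levOf (fun i => {z : Site P 0 | D.InOm i z}) D.k b.tgt * η)⁻¹)) := by
  intro hE
  classical
  set C : ℝ := (((P.d + 2) * P.L : ℕ) : ℝ) with hC
  set t₁ : ℝ := CK * B₃ * (1 + 2 * ((P.d + 2) * P.L : ℕ) * Real.exp (δ * r₁)) * t * Real.exp (δ * r₂) * Real.exp (-(δ * dE b)) with ht₁
  have ht₁0 : 0 ≤ t₁ := by positivity
  -- the pins of the two end-points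
  set p₁ : SiteIdx D := ⟨⟨⟨levOf (fun i => {z : Site P 0 | D.InOm i z}) D.k b.src, pin_mem D b.src⟩,
      iterBlockOf (levOf (fun i => {z : Site P 0 | D.InOm i z}) D.k b.src) b.src⟩, FlatCubeLevels.lamSite_levOf_inOm D b.src⟩ with hp₁
  set p₂ : SiteIdx D := ⟨⟨⟨levOf (fun i => {z : Site P 0 | D.InOm i z}) D.k b.tgt, pin_mem D b.tgt⟩,
      iterBlockOf (levOf (fun i => {z : Site P 0 | D.InOm i z}) D.k b.tgt) b.tgt⟩, FlatCubeLevels.lamSite_levOf_inOm D b.tgt⟩ with hp₂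
  set f : SiteIdx D → ℝ := fun s => |τ s b.tgt - τ s b.src| * ‖Λ (s.1.1 : ℕ) (Y X) s.1.2‖ with hf
  have hf0 : ∀ s, 0 ≤ f s := fun s => by positivity
  have hfzero : ∀ s, s ≠ p₁ → s ≠ p₂ → f s = 0 := by
    intro s h1 h2
    simp only [hf]
    rw [tau_eq_zero_of_ne D τ hτ0 b.tgt s h2, tau_eq_zero_of_ne D τ hτ0 b.src s h1, sub_zero, abs_zero, zero_mul]
  have hfle : ∀ s, f s ≤ (if s = p₁ then f p₁ else 0) + (if s = p₂ then f p₂ else 0) := by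
    intro s
    by_cases h1 : s = p₁
    · subst h1; simp only [if_true]; split_ifs <;> linarith [hf0 p₂]
    · by_cases h2 : s = p₂
      · subst h2; simp only [if_true, if_neg h1]; linarith
      · rw [hfzero s h1 h2, if_neg h1, if_neg h2, add_zero]
  -- the bound on one pin term
  have hpin : ∀ (x : Site P 0), (x = b.src ∨ x = b.tgt) → f ⟨⟨⟨levOf (fun i => {z : Site P 0 | D.InOm i z}) D.k x, pin_mem D x⟩,
      iterBlockOf (levOf (fun i => {z : Site P 0 | D.InOm i z}) D.k x) x⟩, FlatCubeLevels.lamSite_levOf_inOm D x⟩ ≤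
      2 * C * t₁ * (((P.L : ℝ) ^ levOf (fun i => {z : Site P 0 | D.InOm i z}) D.k x * η)⁻¹) := by
    intro x hx
    set j := levOf (fun i => {z : Site P 0 | D.InOm i z}) D.k x with hj
    have hLj : 0 < (P.L : ℝ) ^ j := by have := P.L_pos; positivity
    have hwpos : 0 < (P.L : ℝ) ^ j * η := by positivity
    have hΛ := norm_Lam_pin_le_twisted_terr D η Λ hΛ0 hΛs Xf hXf κ hκ0 hκs Xt hXt H₀ Y hY w₁ hw₁ dBI hd0 hCK hker hrow dE dF hδ hδh htri hF
      hη hB₃ X ht hX b x hx ⟨⟨⟨j, pin_mem D x⟩, iterBlockOf j x⟩, FlatCubeLevels.lamSite_levOf_inOm D x⟩ rfl hE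
    have hτ := hτlip ⟨⟨⟨j, pin_mem D x⟩, iterBlockOf j x⟩, FlatCubeLevels.lamSite_levOf_inOm D x⟩ b
    simp only at hΛ hτ
    simp only [hf]
    calc |τ _ b.tgt - τ _ b.src| * ‖Λ j (Y X) (iterBlockOf j x)‖
        ≤ (2 / (P.L : ℝ) ^ j) * (C * (P.L : ℝ) ^ j * (t₁ / ((P.L : ℝ) ^ j * η))) :=
          mul_le_mul hτ hΛ (norm_nonneg _) (by positivity)
      _ = 2 * C * t₁ * (((P.L : ℝ) ^ j * η)⁻¹) := by field_simp
  -- assemble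
  have hdiff : φ X b.tgt - φ X b.src = ∑ s : SiteIdx D, (τ s b.tgt - τ s b.src) • Λ (s.1.1 : ℕ) (Y X) s.1.2 := by
    rw [hφ, hφ, ← Finset.sum_sub_distrib]
    refine Finset.sum_congr rfl fun s _ => ?_
    rw [sub_smul]
  rw [hdiff]
  calc ‖∑ s : SiteIdx D, (τ s b.tgt - τ s b.src) • Λ (s.1.1 : ℕ) (Y X) s.1.2‖ ≤ ∑ s, f s := by
        refine (norm_sum_le _ _).trans (Finset.sum_le_sum fun s _ => ?_)
        rw [norm_smul, Real.norm_eq_abs]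
    _ ≤ ∑ s, ((if s = p₁ then f p₁ else 0) + (if s = p₂ then f p₂ else 0)) := Finset.sum_le_sum fun s _ => hfle s
    _ = f p₁ + f p₂ := by rw [Finset.sum_add_distrib, Finset.sum_ite_eq' Finset.univ p₁, Finset.sum_ite_eq' Finset.univ p₂]; simp
    _ ≤ 2 * C * t₁ * (((P.L : ℝ) ^ levOf (fun i => {z : Site P 0 | D.InOm i z}) D.k b.src * η)⁻¹) +
          2 * C * t₁ * (((P.L : ℝ) ^ levOf (fun i => {z : Site P 0 | D.InOm i z}) D.k b.tgt * η)⁻¹) :=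
        add_le_add (hpin b.src (Or.inl rfl)) (hpin b.tgt (Or.inr rfl))
    _ = _ := by ring

include hΛ0 hΛs hXf hκ0 hκs hXt hY hτ0 hφ hw₁ hτlip hd0 hCK hker hrow hδ hδh htri hF in
/-- ★★ **THE TWISTED LETTER OF `H X = Y + dφ` (territory-level block slack as a premise)**: under (2.2)-admissibility with `R·M ≥ 1` (territory collar), for data with `e^{δ·dF(c)}‖X(c)‖ ≤ t`:
`e^{δ·dE(b)}·w₁(b)·‖HX(b)‖ ≤ C_KB₃(1 + 2Ce^{δr₁})(1 + 2C(1+L)e^{δr₂})·t`, `C = (d+2)L` — k-UNIFORM; at `δ = 0` this is the weighted sup letter from the kernel row.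
[cite: Balaban1985Variational, (46) p.285, (71) p.289, (161)-(162) p.303; Balaban1984PropagatorsII, Lemma 2.1 p.232] -/
theorem letter_twisted_terr {R M : ℕ} (hAdm : Adm22 D R M) (hRM : 1 ≤ R * M) (hη : 0 < η) (hB₃ : 0 ≤ B₃)
    (Hf : (BondIdx D → Matrix n n ℂ) → PBond P 0 → Matrix n n ℂ) (hHf : ∀ X b, Hf X b = Y X b + (φ X b.tgt - φ X b.src))
    (X : BondIdx D → Matrix n n ℂ) {t : ℝ} (ht : 0 ≤ t) (hX : ∀ c, Real.exp (δ * dF c) * ‖X c‖ ≤ t) (b : PBond P 0) :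
    (∀ (b₁ b' : PBond P 0) (x : Site P 0), (x = b₁.src ∨ x = b₁.tgt) →
      iterBlockOf (levOf (fun i => {z : Site P 0 | D.InOm i z}) D.k x) b'.src = iterBlockOf (levOf (fun i => {z : Site P 0 | D.InOm i z}) D.k x) x →
      dE b₁ ≤ dE b' + r₂) →
    Real.exp (δ * dE b) * (w₁ b * ‖Hf X b‖) ≤
      CK * B₃ * (1 + 2 * ((P.d + 2) * P.L : ℕ) * Real.exp (δ * r₁)) *
        (1 + 2 * ((P.d + 2) * P.L : ℕ) * (1 + P.L) * Real.exp (δ * r₂)) * t := by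
  intro hE
  set C : ℝ := (((P.d + 2) * P.L : ℕ) : ℝ) with hC
  set T₁ : ℝ := CK * B₃ * (1 + 2 * ((P.d + 2) * P.L : ℕ) * Real.exp (δ * r₁)) * t with hT₁
  have hT₁0 : 0 ≤ T₁ := by positivity
  set j₁ := levOf (fun i => {z : Site P 0 | D.InOm i z}) D.k b.src with hj₁
  set j₂ := levOf (fun i => {z : Site P 0 | D.InOm i z}) D.k b.tgt with hj₂
  have hL1 : (1 : ℝ) ≤ P.L := by exact_mod_cast P.L_pos
  have hL0 : (0 : ℝ) < P.L := by positivity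
  have hw : w₁ b = (P.L : ℝ) ^ j₁ * η := hw₁ b
  have hw0 : 0 ≤ w₁ b := by rw [hw]; positivity
  have he0 : 0 < Real.exp (δ * dE b) := Real.exp_pos _
  have hY' := letter_Y_twisted D η Xf hXf κ hκ0 hκs Xt hXt H₀ Y hY w₁ hw₁ dBI hd0 hCK hker hrow dE dF hδ hδh htri hF hη X ht hX b
  have hφ' := norm_dphi_le_twisted_terr D η Λ hΛ0 hΛs Xf hXf κ hκ0 hκs Xt hXt H₀ Y hY τ hτ0 φ hφ w₁ hw₁ hτlip dBI hd0 hCK hker hrow dE dF hδ hδh htri hF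
    hη hB₃ X ht hX b hE
  -- the collar: `j₁ ≤ j₂ + 1`
  have hlev := (levOf_endpoints_le_succ D hAdm hRM b).1
  have hratio : (P.L : ℝ) ^ j₁ * (((P.L : ℝ) ^ j₂ * η)⁻¹ * η) ≤ P.L := by
    rw [mul_inv, mul_assoc, inv_mul_cancel₀ hη.ne', mul_one, ← div_eq_mul_inv, div_le_iff₀ (by positivity), ← pow_succ']
    exact pow_le_pow_right₀ hL1 hlev
  have hself : (P.L : ℝ) ^ j₁ * η * (((P.L : ℝ) ^ j₁ * η)⁻¹) = 1 := mul_inv_cancel₀ (by positivity)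
  have hee : Real.exp (δ * dE b) * Real.exp (-(δ * dE b)) = 1 := by rw [← Real.exp_add, add_neg_cancel, Real.exp_zero]
  -- the gauge part after the twist: the factors `e^{±δdE(b)}` cancel
  have hφ'' : Real.exp (δ * dE b) * (w₁ b * ‖φ X b.tgt - φ X b.src‖) ≤ 2 * C * (T₁ * Real.exp (δ * r₂)) * (1 + P.L) := by
    calc Real.exp (δ * dE b) * (w₁ b * ‖φ X b.tgt - φ X b.src‖)
        ≤ Real.exp (δ * dE b) * (w₁ b * (2 * C * (T₁ * Real.exp (δ * r₂) * Real.exp (-(δ * dE b))) *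
            ((((P.L : ℝ) ^ j₁ * η)⁻¹) + (((P.L : ℝ) ^ j₂ * η)⁻¹)))) := by
          refine mul_le_mul_of_nonneg_left (mul_le_mul_of_nonneg_left ?_ hw0) he0.le
          have := hφ'; simp only [hT₁, hC] at this ⊢; convert this using 2
      _ = 2 * C * (T₁ * Real.exp (δ * r₂)) * (Real.exp (δ * dE b) * Real.exp (-(δ * dE b))) *
            ((P.L : ℝ) ^ j₁ * η * (((P.L : ℝ) ^ j₁ * η)⁻¹) + (P.L : ℝ) ^ j₁ * (((P.L : ℝ) ^ j₂ * η)⁻¹ * η)) := by rw [hw]; ring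
      _ ≤ 2 * C * (T₁ * Real.exp (δ * r₂)) * (1 + P.L) := by
          rw [hee, hself, mul_one]
          have : 0 ≤ 2 * C * (T₁ * Real.exp (δ * r₂)) := by positivity
          nlinarith [hratio]
  calc Real.exp (δ * dE b) * (w₁ b * ‖Hf X b‖)
      ≤ Real.exp (δ * dE b) * (w₁ b * (‖Y X b‖ + ‖φ X b.tgt - φ X b.src‖)) := by
        rw [hHf]; exact mul_le_mul_of_nonneg_left (mul_le_mul_of_nonneg_left (norm_add_le _ _) hw0) he0.le
    _ = Real.exp (δ * dE b) * (w₁ b * ‖Y X b‖) + Real.exp (δ * dE b) * (w₁ b * ‖φ X b.tgt - φ X b.src‖) := by ring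
    _ ≤ T₁ + 2 * C * (T₁ * Real.exp (δ * r₂)) * (1 + P.L) := add_le_add hY' hφ''
    _ = _ := by rw [hT₁, hC]; ring


end Letter

end Construction

end Summit.QuantumFields.YangMills.BalabanUVNodes.N07ChartHInvTwistedTerr

end
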